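import Literature.Analysis.Convexity.Secant
import Mathlib.Analysis.Calculus.ContDiff.RCLike
import Mathlib.Analysis.Normed.Module.FiniteDimension
import Mathlib.Topology.MetricSpace.Thickening
import HarnessLib

/-!
# Compact-set calculus for the band reading of the vertex stage

Topic `Literature/Topology/FourManifolds`; elementary uniform estimates used when a vertex of the
triangulation reads the crease record of an incident edge through the chart transitions
(Munkres, Ann. of Math. 72 (1960), §5; Campbell–D'Onofrio–Vítek (2026), Lemma 3.2;
`CreaseBandReading.lean`).  All constants are suprema/infima of continuous quantities over
compact sets, fixed BEFORE the band width `ε` is chosen: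

* `exists_norm_fderiv_le_of_isCompact` — `‖Df‖ ≤ M` on a compact subset of an open set of
  smoothness;
* `exists_fderiv_lower_bound_of_isCompact` — a uniform lower bound `a ‖w‖ ≤ ‖Df(x) w‖` on a
  compact set where every `Df(x)` is injective (finite dimension);
* `exists_local_lipschitz_fderiv_of_isCompact` — a Lebesgue number `δ₀` and a constant `L` with
  `‖Df(y) - Df(x)‖ ≤ L ‖y - x‖` for `x` in the compact set and `‖y - x‖ < δ₀`;
* `abs_snd_radial_le` — the algebra of the "radial vector is almost tangent" estimate: with
  `z_b - z₁ = λ • γ' - R` and `(D_b γ').2 = 0`,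
  `|(D_z (z - z₁)).2| ≤ ‖D_z‖ ‖z - z_b‖ + ‖D_z - D_b‖ ‖z_b - z₁‖ + ‖D_b‖ ‖R‖`;
* `norm_le_of_record` — `‖T‖ ≤ 1 + ε + C₀ + |A₀|` for an operator with the crease record;
* `norm_curve_taylor_le` — the 1-D Taylor remainder of a `C²` curve from the secant lemma.

Everything is proved; no definitions; no named facts.

## References

* J. R. Munkres, *Obstructions to the smoothing of piecewise-differentiable homeomorphisms*, Ann.
  of Math. (2) 72 (1960), 521–554, §5. [Munkres1960]
* D. Campbell, L. D'Onofrio, T. Vítek, *Diffeomorphic approximation of piecewise affine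
  homeomorphisms*, J. Geom. Anal. 36 (2026), Lemma 3.2. [CampbellDonofrioVitek2026]
-/

noncomputable section

open Set Function Metric Filter
open scoped Topology ContDiff NNReal

namespace Literature.Topology.FourManifolds

variable {F : Type*} [NormedAddCommGroup F] [NormedSpace ℝ F]
variable {G : Type*} [NormedAddCommGroup G] [NormedSpace ℝ G]

/-! ### Suprema and infima over compact sets -/

/-- **`‖Df‖ ≤ M` on a compact subset** of an open set where `f` is `C¹`. [folklore] -/
theorem exists_norm_fderiv_le_of_isCompact {f : F → G} {U K : Set F} (hU : IsOpen U)
    (hf : ContDiffOn ℝ 1 f U) (hK : IsCompact K) (hKU : K ⊆ U) :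
    ∃ M : ℝ, 0 < M ∧ ∀ x ∈ K, ‖fderiv ℝ f x‖ ≤ M := by
  have hcont : ContinuousOn (fderiv ℝ f) K := (hf.continuousOn_fderiv_of_isOpen hU le_rfl).mono hKU
  obtain ⟨M, hM⟩ := (hK.image_of_continuousOn hcont).isBounded.exists_norm_le
  exact ⟨max M 1, by positivity, fun x hx => (hM _ ⟨x, hx, rfl⟩).trans (le_max_left _ _)⟩

/-- **Uniform lower bound of injective derivatives on a compact set** (finite dimension): if
`f` is `C¹` on an open `U ⊇ K` and `Df(x)` is injective for every `x ∈ K`, then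
`a ‖w‖ ≤ ‖Df(x) w‖` for some `a > 0` and all `x ∈ K`, `w`. [folklore] -/
theorem exists_fderiv_lower_bound_of_isCompact [FiniteDimensional ℝ F] {f : F → G} {U K : Set F}
    (hU : IsOpen U) (hf : ContDiffOn ℝ 1 f U) (hK : IsCompact K) (hKU : K ⊆ U)
    (hinj : ∀ x ∈ K, Injective (fderiv ℝ f x)) :
    ∃ a : ℝ, 0 < a ∧ ∀ x ∈ K, ∀ w, a * ‖w‖ ≤ ‖fderiv ℝ f x w‖ := by
  have hcont : ContinuousOn (fderiv ℝ f) K := (hf.continuousOn_fderiv_of_isOpen hU le_rfl).mono hKU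
  -- the continuous positive function `(x, w) ↦ ‖Df x w‖` on the compact `K × sphere`
  by_cases hS : (K ×ˢ sphere (0 : F) 1).Nonempty
  · have hc : ContinuousOn (fun p : F × F => ‖fderiv ℝ f p.1 p.2‖) (K ×ˢ sphere (0 : F) 1) := by
      refine ContinuousOn.norm ?_
      have h1 : ContinuousOn (fun p : F × F => fderiv ℝ f p.1) (K ×ˢ sphere (0 : F) 1) :=
        hcont.comp continuous_fst.continuousOn fun p hp => hp.1
      exact h1.clm_apply continuous_snd.continuousOn
    obtain ⟨⟨x₀, w₀⟩, hmem, hmin⟩ :=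
      (hK.prod (isCompact_sphere 0 1)).exists_isMinOn hS hc
    have hpos : 0 < ‖fderiv ℝ f x₀ w₀‖ := by
      rw [norm_pos_iff]
      intro h0
      have hw₀ : w₀ ≠ 0 := by
        have : ‖w₀‖ = 1 := by simpa using hmem.2
        rw [← norm_ne_zero_iff, this]; exact one_ne_zero
      exact hw₀ ((hinj x₀ hmem.1).eq_iff' (map_zero _) |>.1 h0)
    refine ⟨‖fderiv ℝ f x₀ w₀‖, hpos, fun x hx w => ?_⟩
    by_cases hw : w = 0
    · simp [hw]
    · have hn : 0 < ‖w‖ := norm_pos_iff.2 hw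
      have hunit : ‖w‖⁻¹ • w ∈ sphere (0 : F) 1 := by
        simp [norm_smul, inv_mul_cancel₀ hn.ne']
      have h : ‖fderiv ℝ f x₀ w₀‖ ≤ ‖fderiv ℝ f x (‖w‖⁻¹ • w)‖ :=
        hmin (show (x, ‖w‖⁻¹ • w) ∈ K ×ˢ sphere (0 : F) 1 from ⟨hx, hunit⟩)
      rw [map_smul, norm_smul, norm_inv, norm_norm, le_inv_mul_iff₀ hn] at h
      linarith [h]
  · refine ⟨1, one_pos, fun x hx w => ?_⟩
    -- no unit vectors: `F` is trivial, so `w = 0`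
    have hw : w = 0 := by
      by_contra hw
      have hn : 0 < ‖w‖ := norm_pos_iff.2 hw
      exact hS ⟨(x, ‖w‖⁻¹ • w), hx, by simp [norm_smul, inv_mul_cancel₀ hn.ne']⟩
    simp [hw]

/-- **Local Lipschitz bound of the derivative near a compact set**: if `f` is `C²` on an open
`U ⊇ K`, there are `δ₀ > 0` and `L ≥ 0` with `ball x δ₀ ⊆ U` and
`‖Df(y) - Df(x)‖ ≤ L ‖y - x‖` for all `x ∈ K` and `‖y - x‖ < δ₀`. [folklore] -/
theorem exists_local_lipschitz_fderiv_of_isCompact [FiniteDimensional ℝ F] {f : F → G}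
    {U K : Set F} (hU : IsOpen U) (hf : ContDiffOn ℝ 2 f U) (hK : IsCompact K) (hKU : K ⊆ U) :
    ∃ δ₀ L : ℝ, 0 < δ₀ ∧ 0 ≤ L ∧ ∀ x ∈ K, ball x δ₀ ⊆ U ∧
      ∀ y ∈ ball x δ₀, ‖fderiv ℝ f y - fderiv ℝ f x‖ ≤ L * ‖y - x‖ := by
  -- a compact thickening inside `U`
  obtain ⟨δ₁, hδ₁, hthick⟩ := hK.exists_cthickening_subset_open hU hKU
  set K' : Set F := cthickening δ₁ K with hK'
  have hK'c : IsCompact K' := hK.cthickening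
  -- `Df` is `C¹` on `U`; bound its derivative on `K'`
  have hDf : ContDiffOn ℝ 1 (fderiv ℝ f) U := hf.fderiv_of_isOpen hU (by norm_num)
  obtain ⟨L, hL0, hL⟩ := exists_norm_fderiv_le_of_isCompact hU hDf hK'c hthick
  refine ⟨δ₁, L, hδ₁, hL0.le, fun x hx => ?_⟩
  have hballK' : ball x δ₁ ⊆ K' := fun y hy =>
    mem_cthickening_of_dist_le y x δ₁ K hx (mem_ball.1 hy).le
  have hballU : ball x δ₁ ⊆ U := hballK'.trans hthick
  refine ⟨hballU, fun y hy => ?_⟩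
  -- mean value inequality for `Df` on the convex ball
  have hdiff : ∀ z ∈ ball x δ₁, HasFDerivWithinAt (fderiv ℝ f) (fderiv ℝ (fderiv ℝ f) z) (ball x δ₁) z :=
    fun z hz => ((hDf.differentiableOn one_ne_zero).differentiableAt (hU.mem_nhds (hballU hz))).hasFDerivAt.hasFDerivWithinAt
  have := (convex_ball x δ₁).norm_image_sub_le_of_norm_hasFDerivWithin_le hdiff
    (fun z hz => hL z (hballK' hz)) (mem_ball_self hδ₁) hy
  simpa [norm_sub_rev] using this

/-! ### The radial-tangency algebra -/

variable {E' : Type*} [NormedAddCommGroup E'] [NormedSpace ℝ E']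

/-- **The radial vector is almost tangent** (algebraic core). [folklore] -/
theorem abs_snd_radial_le (Dz Db : F →L[ℝ] E' × ℝ) {z z_b z₁ γ' R : F} {lam : ℝ}
    (hdec : z_b - z₁ = lam • γ' - R) (htan : (Db γ').2 = 0) :
    |(Dz (z - z₁)).2| ≤ ‖Dz‖ * ‖z - z_b‖ + ‖Dz - Db‖ * ‖z_b - z₁‖ + ‖Db‖ * ‖R‖ := by
  have e : Dz (z - z₁) = Dz (z - z_b) + (Dz - Db) (z_b - z₁) + Db (z_b - z₁) := by
    have : z - z₁ = (z - z_b) + (z_b - z₁) := by abel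
    rw [this, map_add]; simp only [FunLike.coe_sub, Pi.sub_apply]; abel
  have e2 : (Db (z_b - z₁)).2 = -(Db R).2 := by
    rw [hdec, map_sub, map_smul, Prod.snd_sub, Prod.smul_snd, htan, smul_zero, zero_sub]
  have h1 : |(Dz (z - z_b)).2| ≤ ‖Dz‖ * ‖z - z_b‖ := by
    calc |(Dz (z - z_b)).2| = ‖(Dz (z - z_b)).2‖ := (Real.norm_eq_abs _).symm
      _ ≤ ‖Dz (z - z_b)‖ := norm_snd_le _
      _ ≤ ‖Dz‖ * ‖z - z_b‖ := Dz.le_opNorm _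
  have h2 : |((Dz - Db) (z_b - z₁)).2| ≤ ‖Dz - Db‖ * ‖z_b - z₁‖ := by
    calc |((Dz - Db) (z_b - z₁)).2| = ‖((Dz - Db) (z_b - z₁)).2‖ := (Real.norm_eq_abs _).symm
      _ ≤ ‖(Dz - Db) (z_b - z₁)‖ := norm_snd_le _
      _ ≤ ‖Dz - Db‖ * ‖z_b - z₁‖ := (Dz - Db).le_opNorm _
  have h3 : |(Db (z_b - z₁)).2| ≤ ‖Db‖ * ‖R‖ := by
    rw [e2, abs_neg]
    calc |(Db R).2| = ‖(Db R).2‖ := (Real.norm_eq_abs _).symm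
      _ ≤ ‖Db R‖ := norm_snd_le _
      _ ≤ ‖Db‖ * ‖R‖ := Db.le_opNorm _
  rw [e, Prod.snd_add, Prod.snd_add]
  calc |(Dz (z - z_b)).2 + ((Dz - Db) (z_b - z₁)).2 + (Db (z_b - z₁)).2|
      ≤ |(Dz (z - z_b)).2 + ((Dz - Db) (z_b - z₁)).2| + |(Db (z_b - z₁)).2| := abs_add_le _ _
    _ ≤ |(Dz (z - z_b)).2| + |((Dz - Db) (z_b - z₁)).2| + |(Db (z_b - z₁)).2| := by
        gcongr; exact abs_add_le _ _
    _ ≤ _ := by linarith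

/-! ### The operator norm of a crease-record derivative -/

/-- **`‖T‖ ≤ 1 + ε + C₀ + |A₀|`** for an operator `T` of `E' × ℝ` with the crease record:
`‖T (v,0) - (v,0)‖ ≤ ε ‖v‖`, `a₀ ≤ (T (0,1)).2 ≤ A₀` (`a₀ > 0`), `‖(T (0,1)).1‖ ≤ C₀`. [folklore] -/
theorem norm_le_of_record {T : E' × ℝ →L[ℝ] E' × ℝ} {ε a₀ A₀ C₀ : ℝ} (hε0 : 0 ≤ ε) (ha₀ : 0 < a₀)
    (hface : ∀ v : E', ‖T (v, 0) - (v, 0)‖ ≤ ε * ‖v‖) (ha : a₀ ≤ (T (0, 1)).2)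
    (hA : (T (0, 1)).2 ≤ A₀) (hC : ‖(T (0, 1)).1‖ ≤ C₀) : ‖T‖ ≤ 1 + ε + C₀ + |A₀| := by
  have hC₀ : 0 ≤ C₀ := (norm_nonneg _).trans hC
  refine ContinuousLinearMap.opNorm_le_bound _ (by positivity) fun p => ?_
  obtain ⟨v, t⟩ := p
  have hdec : T (v, t) = T (v, 0) + t • T (0, 1) := by
    have : ((v, t) : E' × ℝ) = (v, 0) + t • ((0 : E'), (1 : ℝ)) := by ext <;> simp
    rw [this, map_add, map_smul]
  have hv : ‖v‖ ≤ ‖((v, t) : E' × ℝ)‖ := norm_fst_le ((v, t) : E' × ℝ)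
  have ht : |t| ≤ ‖((v, t) : E' × ℝ)‖ := by
    have := norm_snd_le ((v, t) : E' × ℝ); rwa [Real.norm_eq_abs] at this
  have h1 : ‖T (v, 0)‖ ≤ (1 + ε) * ‖v‖ := by
    have := norm_le_insert' (T (v, 0)) ((v, 0) : E' × ℝ)
    have hn : ‖((v, 0) : E' × ℝ)‖ = ‖v‖ := by simp [Prod.norm_def]
    rw [hn] at this
    nlinarith [hface v]
  have h2 : ‖T (0, 1)‖ ≤ C₀ + |A₀| := by
    rw [Prod.norm_def]
    refine max_le (hC.trans (by linarith [abs_nonneg A₀])) ?_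
    rw [Real.norm_eq_abs]
    have hpos : 0 < (T (0, 1)).2 := ha₀.trans_le ha
    rw [abs_of_pos hpos]
    exact hA.trans ((le_abs_self A₀).trans (by linarith))
  rw [hdec]
  calc ‖T (v, 0) + t • T (0, 1)‖ ≤ ‖T (v, 0)‖ + ‖t • T (0, 1)‖ := norm_add_le _ _
    _ ≤ (1 + ε) * ‖v‖ + |t| * (C₀ + |A₀|) := by
        rw [norm_smul, Real.norm_eq_abs]; gcongr
    _ ≤ (1 + ε) * ‖((v, t) : E' × ℝ)‖ + ‖((v, t) : E' × ℝ)‖ * (C₀ + |A₀|) := by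
        gcongr
    _ = (1 + ε + C₀ + |A₀|) * ‖((v, t) : E' × ℝ)‖ := by ring

/-! ### Taylor remainder of a curve -/

/-- **1-D Taylor remainder from the secant lemma**: if `γ : ℝ → F` is differentiable on a convex
set `s` of parameters with `L`-Lipschitz derivative (as `ℝ →L F`), then for `0, λ ∈ s`:
`‖γ 0 - γ λ - (fderiv ℝ γ λ) (0 - λ)‖ ≤ (L |λ|) |λ|`. [folklore] -/
theorem norm_curve_taylor_le {γ : ℝ → F} {s : Set ℝ} (hs : Convex ℝ s)
    (hγ : ∀ t ∈ s, HasFDerivWithinAt γ (fderiv ℝ γ t) s t) {L : ℝ≥0}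
    (hL : LipschitzOnWith L (fderiv ℝ γ) s) {lam : ℝ} (h0 : (0 : ℝ) ∈ s) (hlam : lam ∈ s) :
    ‖γ 0 - γ lam - fderiv ℝ γ lam (0 - lam)‖ ≤ (L * |lam|) * |lam| := by
  have := Literature.Analysis.Convexity.norm_sub_sub_fderiv_le_of_lipschitzOnWith hs hγ hL hlam h0
  simpa [Real.norm_eq_abs, abs_neg] using this

end Literature.Topology.FourManifolds
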